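import Literature.NumberTheory.Rogawski1990.ArchOrbFamGExtJumpWall02Dress       -- ★ p851158 (this seat) PART 1: the two dresses `archERhoG_mul_orbFamGExt_eq_compactReader ∕ _eq_splitReader`, `eq_smul_integral_prod_of_splitToken`; brings ★ p851099, ★ p851074, ★ (c-wall), ★ (B-wick)
import Literature.NumberTheory.Rogawski1990.ArchHcJumpTwoChart                 -- ★ p851048 (this seat) (B-trans) MAIN `hasOneSidedJump_iteratedFDeriv_adaptedWord_of_twoChart`
import Literature.NumberTheory.Automorphic.ArchRankOneJumpAllOrdersChart       -- ★ p851059 (F0P3a-p09 (g6)) (B-r1) `exists_hasOneSidedJump_iteratedDeriv_allOrders_chart_of_eq_over`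
import Literature.NumberTheory.Automorphic.ArchRankOneOrbitalFamilyParamCayley -- ★ p851143 (F0P3a-p04 (g24)) (B-par) Cayley edition: `contDiffOn_cayley_orbitalIntegral_param`, `fderiv_cayley_orbitalIntegral_param_prod_apply`, `fderiv_splitIntegral_param_prod_apply`; brings ★ p851042, ★ p851003
import Literature.NumberTheory.Automorphic.ArchRankOneFamilyCentre             -- ★ p851073 (this seat): `contDiff_uncurry_centreAbsorb`, `exists_isCompact_forall_centreAbsorb_eq_zero`
import Literature.NumberTheory.Automorphic.ArchSharedRankOneDatumTorus         -- ★ (F0P3-p02): `ne_zero_of_sharedA0`; brings ★ p850571 `sharedRankOneDatum_exists`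
import Literature.NumberTheory.Rogawski1990.ArchDeltaTransferOfChartRead       -- ★ p850246: frame bridges `ne_zero_of_diagonal_anisotropic`, `complexConj_apply_eq_of_diagonal_frame`
import Literature.NumberTheory.Rogawski1990.ArchOrbFamGExtWallDescentDress   -- ★ p851164 (LH3-p02 (g4)): `contDiffOn_frozenProd`, `isOpen_setOf_forall_mem_apply_ne_zero` (shared with the (I₁) dress)
import HarnessLib

/-!
# (B-jc) THE (0,2)-JUNCTION, part 2 — `HcJumpWall02Statement`: the one-sided jumps of ALL adapted-word derivatives of `e^{ρ}·orbFamGExt ν′ a′ S′` across the noncompact wall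
# `(w, 0, 2)` at every semiregular wall point, with ONE constant `J` (Harish-Chandra's jump relations; Shelstad 1979 Lemma 4.3 ∕ Prop. 4.5; Bouaziz 1994 §3.2 (I₃); Rogawski 1990 §8.2)

Topic `NumberTheory/Rogawski1990`; namespace `Literature.NumberTheory.Rogawski1990`.  THEOREMS ONLY (no `def`, no instance, no notation, no axiom, no named fact, no `sorry`);
kernel lane `--kind proof --supports stmt-HodgeConjecture-24833`.  Cell `pub/hodgecm-mathlib`, crux H413 (`stmt-HodgeConjecture-24833`), F0∕P3c line LH3, leaf
`F0_P3c_StubN9Direct` v5, organ **O-L1b′ `stub_N9hcJumpWall02 : HcJumpWall02Statement`**; SPEC-I3 brick (B-jc) (F0P3a-p08 (g23), (I₃) spec-owner).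

THE HEAD **`hasOneSidedJump_hcTwistedDeriv_orbFamGExt_wall02 (L α) [inst] (ν′) [Haar, right-invariant] (hherm) (hanis) (S′) (hS′) (w) (hw) (hwsp) :
  ∃ J : ℂ, ∀ a′, ArchSmooth L 3 (diagonal α) a′ → ∀ p, HcSemireg S′ w 0 2 p → ∀ n m,
    HasOneSidedJump (fun ν => hcTwistedDeriv S′ n (hcAdaptedVec w 0 2 ∘ m) (orbFamGExt L α ν′ a′ S′) (p + ν • hcNrm w 0 2))
      (J * hcCayScalar w 0 m * hcTwistedDeriv (insert w S′) n (hcCayVec w 0 2 ∘ m) (orbFamGExt L α ν′ a′ (insert w S′)) (hcCayPt w 0 2 p))`**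
is the body of `HcJumpWall02Statement` after its frame binders, DATUM-FREE.  PROOF = ★ (B-trans) p851048 `hasOneSidedJump_iteratedFDeriv_adaptedWord_of_twoChart` instantiated ONCE:
* the carrier: the standard `U(J)`, `J = Φ₂ ⊗ ℂ`, with the SHARED rank-one datum `(μ₀, μ₀′, hlink)` (★ p850571 `sharedRankOneDatum_exists`, `μ₀′ ≠ 0` by ★ `ne_zero_of_sharedA0`), the
  Iwasawa circle `K₁ = {k_s}` with its Haar measure (★ `isHaarMeasure_map_rotLift`, ★ `exists_rotLift_mul_mem_borelU`), `μ_N` Haar on `N`, and `μ₀′ = C′ • ((k,n) ↦ knT)_*(κ ⊗ μ_N)`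
  (★ `exists_measure_quotient_torusU_complex_two_eq_smul_map`);
* the readers: `Φ₁ F ψ = (2 sin ψ)·∫_{U(J)} F(↑↑(h P diag(e^{i0}e^{iψ}, e^{i0}e^{−iψ}) P⁻¹ h⁻¹)) dμ₀` on `T₁ = {sin ψ ≠ 0}` and `Φ₂ F x = ∫_{K₁×N} F(↑↑(k t_{0,0} h_{x∕2} n h_{x∕2} k⁻¹)) d(κ ⊗ μ_N)` —
  (H1)(H2) by ★ p851143 (Cayley edition) ∕ ★ p851042, the family class `Adm g = (C^∞ jointly) ∧ (one compact support)` closed under `D v g = ∂_v g` (★ p851003);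
* `hjump` with ONE `κ₀ > 0` for ALL test functions: ★ (B-r1) p851059 at `θ = 0`; `hwick`: ★ `iteratedDeriv_ofReal_two_cos_sub_zero_eq_I_pow_mul`;
* per `(a′, p)`: ★ p851099 `exists_twoChart_descent_orbFamGExt_realWall` gives ONE `K ≠ 0`, ONE block family `f`, the smooth split token `G`; PART 1's dresses give `hdesc₁` (`K₁ = K·i`, on
  `U ∩ U₀` off the wall: ★ `exists_nhds_hcSemireg` + ★ `mem_regG_of_offWall`) and `hdesc₂` (`K₂ = K·C′`, on `U″ ∩ InRegG`: ★ `isOpen_inRegG` + ★ `hcCayPt_mem_inRegG_insert`), with the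
  centre-absorbed family `g q X = f (q, e^{i(q_{w0}+q_{w2})∕2} • X)` (★ p851073) and the frozen cofactors `Π`, `E` (`C^∞` near `p`: ★ `contDiffOn_frozenProd`, §1);
* so `J = (K·i)∕(K·C′)·κ₀ = i·κ₀∕C′` — the descent constant CANCELS and `J` depends on the datum only (hence `∃ J` BEFORE `∀ a′ p`).
HONEST LABEL: count-neutral; HC_CM is proved only modulo the 7 printed citations (2 remaining: hLiu418 = stmt-HodgeConjecture-24832, h413 = stmt-HodgeConjecture-24833) until rung 0 closes.

## References
* [Shelstad1979] D. Shelstad, *Characters and inner forms of a quasi-split group over ℝ*, Compositio Math. 39 (1979), Lemma 4.3 p. 25, Prop. 4.5 p. 26, Thm. 4.7 p. 31.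
* [Bouaziz1994IntegralesOrbitales] A. Bouaziz, *Intégrales orbitales sur les groupes de Lie réductifs*, Ann. Sci. ÉNS 27 (1994), §3.2 (I₃) p. 580.
* [Rogawski1990] J. D. Rogawski, *Automorphic Representations of Unitary Groups in Three Variables*, Ann. of Math. Stud. 123 (1990), §8.2 pp. 118–124.
* [Varadarajan1977] V. S. Varadarajan, *Harmonic Analysis on Real Reductive Groups*, LNM 576 (1977), Part I §1.12.
* [Varadarajan1989] V. S. Varadarajan, *An Introduction to Harmonic Analysis on Semisimple Lie Groups*, CUP (1989), §6.4 Thm 23–24.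
-/

set_option autoImplicit false

noncomputable section

open MeasureTheory MeasureTheory.Measure NumberField NumberField.InfinitePlace Matrix Complex Set Filter Topology Function
open scoped MatrixGroups Matrix Real Classical ENNReal NNReal ContDiff Matrix.Norms.Operator
open Literature.NumberTheory.Automorphic Literature.NumberTheory.Automorphic.UnitaryGroup Literature.NumberTheory.Automorphic.ArchCartan
open Literature.NumberTheory.Automorphic.RankOneCasimir Literature.NumberTheory.Automorphic.Shelstad1979.StableOrbitalIntegrals
open Literature.MeasureTheory.Group Literature.Analysis.Calculus

namespace Literature.NumberTheory.Rogawski1990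

/-! ## §1 The frozen cofactor `E` is smooth near a semiregular wall point (`Π`: ★ `contDiffOn_frozenProd`) -/

section Frozen

variable {W : Type*} [Fintype W] [DecidableEq W]

/-- **`E q = (2cos(q_{w0} − q_{w1}) − 2cos δ₀)·Π q` is `C^∞` on the same carrier.** [cite: Shelstad1979, Lemma 4.3 (p. 25)] [cite: Rogawski1990, §8.2 p. 122] -/
theorem contDiffOn_twoCosSub_mul_frozenProd (S : Finset W) (w : W) (δ₀ : ℝ) :
    ContDiffOn ℝ ∞ (fun q : W → Fin 3 → ℝ => (((2 * Real.cos (q w 0 - q w 1) - 2 * Real.cos δ₀ : ℝ)) : ℂ) * (∏ w' ∈ Finset.univ.erase w,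
            ((if w' ∈ S then (1 : ℂ) else (Circle.exp (q w' 0 - q w' 2) : ℂ)) *
              (if w' ∈ S then
                  ((|Real.exp (q w' 0) - Real.exp (-q w' 0)| *
                    ‖cexp (q w' 0 + q w' 2 * I) - cexp (q w' 1 * I)‖ * ‖cexp (-q w' 0 + q w' 2 * I) - cexp (q w' 1 * I)‖ : ℝ) : ℂ)
                else (1 - (Circle.exp (q w' 1 - q w' 0) : ℂ)) * (1 - (Circle.exp (q w' 2 - q w' 0) : ℂ)) * (1 - (Circle.exp (q w' 2 - q w' 1) : ℂ))))))
      {q : W → Fin 3 → ℝ | ∀ w' ∈ S, w' ≠ w → q w' 0 ≠ 0} := by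
  have hc : ∀ (w' : W) (l : Fin 3), ContDiff ℝ ∞ fun q : W → Fin 3 → ℝ => q w' l := fun w' l => contDiff_apply_apply (𝕜 := ℝ) (E := ℝ) w' l
  have h1 : ContDiff ℝ ∞ fun q : W → Fin 3 → ℝ => (((2 * Real.cos (q w 0 - q w 1) - 2 * Real.cos δ₀ : ℝ)) : ℂ) :=
    Complex.ofRealCLM.contDiff.comp (((contDiff_const.mul (Real.contDiff_cos.comp ((hc w 0).sub (hc w 1)))).sub contDiff_const))
  exact h1.contDiffOn.mul (contDiffOn_frozenProd S w)

end Frozen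

/-! ## §2 The head -/

section Main

variable (L : Type) [Field L] [NumberField L] [IsCMField L] (α : Fin 3 → L)
  [MeasurableSpace ↥(arch (↥(maximalRealSubfield L)) L (IsCMField.complexConj L) 3 (Matrix.diagonal α))] [BorelSpace ↥(arch (↥(maximalRealSubfield L)) L (IsCMField.complexConj L) 3 (Matrix.diagonal α))]
  (ν' : Measure ↥(arch (↥(maximalRealSubfield L)) L (IsCMField.complexConj L) 3 (Matrix.diagonal α))) [ν'.IsHaarMeasure] [ν'.IsMulRightInvariant]

/-- **(B-jc) THE (0,2)-JUNCTION = `HcJumpWall02Statement`'s body.**  For a house frame (`hherm`, `hanis`), an admissible compact chart `S′` and a covered split place `w ∉ S′` there is ONE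
`J ∈ ℂ` such that for every `a′ ∈ C_c^∞(G′_∞)`, every semiregular point `p` of the noncompact wall `(w, 0, 2)`, every order `n` and every adapted word `m`,
`ν ↦ D^n[e^{ρ}·orbFamGExt ν′ a′ S′](p + ν • hcNrm)(hcAdaptedVec ∘ m)` has the one-sided jump `J · hcCayScalar w 0 m · D^n[e^{ρ}·orbFamGExt ν′ a′ (S′ ∪ {w})](hcCayPt p)(hcCayVec ∘ m)` at `ν = 0`
(Harish-Chandra's jump relations for `U(2,1)`: ★ (B-trans) two-chart word reduction + ★ (B-r1) rank-one all-orders jump + ★ (B-desc-hyp) two-chart descent + PART 1's dresses; `J = i·κ₀∕C′`).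
[cite: Shelstad1979, Lemma 4.3 (p. 25), Prop. 4.5 (p. 26)] [cite: Bouaziz1994IntegralesOrbitales, §3.2 (I₃) p. 580] [cite: Rogawski1990, §8.2 pp. 118–124] [cite: Varadarajan1977, I §1.12] -/
theorem hasOneSidedJump_hcTwistedDeriv_orbFamGExt_wall02
    (hherm : ((Matrix.diagonal α).map (cmConjRingHom L)).transpose = Matrix.diagonal α)
    (hanis : ∀ x : Fin 3 → L, Literature.AlgebraicGeometry.ShimuraVarieties.hermForm (cmConjRingHom L) (Matrix.diagonal α) x x = 0 → x = 0)
    (S' : Finset {w : InfinitePlace L // IsComplex w}) (hS' : ∀ w, w ∈ S' → w ∈ splitChartPlaces L α)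
    (w : {w : InfinitePlace L // IsComplex w}) (hw : w ∉ S') (hwsp : w ∈ splitChartPlaces L α) :
    ∃ J : ℂ, ∀ a' : ↥(arch (↥(maximalRealSubfield L)) L (IsCMField.complexConj L) 3 (Matrix.diagonal α)) → ℂ, ArchSmooth L 3 (Matrix.diagonal α) a' →
      ∀ p : {w : InfinitePlace L // IsComplex w} → Fin 3 → ℝ, HcSemireg S' w 0 2 p → ∀ (n : ℕ) (m : Fin n → {w : InfinitePlace L // IsComplex w} × Fin 3),
        HasOneSidedJump
          (fun ν : ℝ => hcTwistedDeriv S' n (fun r => hcAdaptedVec w 0 2 (m r)) (orbFamGExt L α ν' a' S') (p + ν • hcNrm w 0 2))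
          (J * hcCayScalar w 0 m * hcTwistedDeriv (insert w S') n (fun r => hcCayVec w 0 2 (m r)) (orbFamGExt L α ν' a' (insert w S')) (hcCayPt w 0 2 p)) := by
  -- the frame
  have hα : ∀ i, α i ≠ 0 := ne_zero_of_diagonal_anisotropic hanis
  have hreal : ∀ (w' : {w : InfinitePlace L // IsComplex w}) (i : Fin 3), (w'.1.embedding (α i)).im = 0 :=
    im_embedding_diagonal_eq_zero L 3 α (complexConj_apply_eq_of_diagonal_frame hherm)
  -- the standard rank-one carrier `U(J)` and its subgroups
  obtain ⟨J, hJ⟩ : ∃ J : Matrix (Fin 2) (Fin 2) ℂ, J = (StdForm.antidiagonal 2).over ℂ := ⟨_, rfl⟩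
  letI : MeasurableSpace ↥(unitaryGroupOfForm (starRingEnd ℂ) J) := borel _
  haveI : BorelSpace ↥(unitaryGroupOfForm (starRingEnd ℂ) J) := ⟨rfl⟩
  haveI : LocallyCompactSpace ↥(unitaryGroupOfForm (starRingEnd ℂ) J) := locallyCompactSpace_unitaryGroupOfForm_complex J
  haveI : SecondCountableTopology ↥(unitaryGroupOfForm (starRingEnd ℂ) J) := secondCountableTopology_unitaryGroupOfForm_complex J
  letI : MeasurableSpace (↥(unitaryGroupOfForm (starRingEnd ℂ) J) ⧸ torusU (starRingEnd ℂ) J) := borel _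
  haveI : BorelSpace (↥(unitaryGroupOfForm (starRingEnd ℂ) J) ⧸ torusU (starRingEnd ℂ) J) := ⟨rfl⟩
  haveI : Fact (0 < 2 * Real.pi) := ⟨Real.two_pi_pos⟩
  have hTUc : IsClosed ((torusU (starRingEnd ℂ) J : Subgroup ↥(unitaryGroupOfForm (starRingEnd ℂ) J)) : Set ↥(unitaryGroupOfForm (starRingEnd ℂ) J)) := LineRing.isClosed_torusU_two _ _
  have hNc : IsClosed ((unipotentU (starRingEnd ℂ) J : Subgroup ↥(unitaryGroupOfForm (starRingEnd ℂ) J)) : Set ↥(unitaryGroupOfForm (starRingEnd ℂ) J)) := LineRing.isClosed_unipotentU _ _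
  haveI : LocallyCompactSpace ↥(torusU (starRingEnd ℂ) J) := hTUc.isClosedEmbedding_subtypeVal.locallyCompactSpace
  haveI : SecondCountableTopology ↥(torusU (starRingEnd ℂ) J) := TopologicalSpace.Subtype.secondCountableTopology _
  haveI : BorelSpace ↥(torusU (starRingEnd ℂ) J) := Subtype.borelSpace _
  haveI : LocallyCompactSpace ↥(unipotentU (starRingEnd ℂ) J) := hNc.isClosedEmbedding_subtypeVal.locallyCompactSpace
  haveI : SecondCountableTopology ↥(unipotentU (starRingEnd ℂ) J) := TopologicalSpace.Subtype.secondCountableTopology _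
  haveI : BorelSpace ↥(unipotentU (starRingEnd ℂ) J) := Subtype.borelSpace _
  -- the SHARED rank-one datum
  obtain ⟨μ₀, hμ₀H, hμ₀R, μ₀', hμ₀'i, hμ₀'f, C₁, C₂, -, hC₂, -, hA0, hlink⟩ := sharedRankOneDatum_exists hJ
  haveI := hμ₀H
  haveI := hμ₀R
  haveI := hμ₀'i
  haveI := hμ₀'f
  have hμ0 : μ₀' ≠ 0 := ne_zero_of_sharedA0 hJ μ₀' hC₂ hA0
  -- the Iwasawa circle `K₁ = {k_s}`: compact, `U(J) = K₁·B`, Haar measure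
  obtain ⟨K₁, hK₁def⟩ : ∃ K₁ : Subgroup ↥(unitaryGroupOfForm (starRingEnd ℂ) J), (K₁ : Set ↥(unitaryGroupOfForm (starRingEnd ℂ) J)) =
      Set.range (fun s : AddCircle (2 * Real.pi) =>
        (⟨archPlaneLiftGL 1 (rotMat s) (det_rotMat s), archPlaneLiftGL_rotMat_mem hJ s⟩ : ↥(unitaryGroupOfForm (starRingEnd ℂ) J))) :=
    ⟨{ carrier := Set.range (fun s : AddCircle (2 * Real.pi) =>
          (⟨archPlaneLiftGL 1 (rotMat s) (det_rotMat s), archPlaneLiftGL_rotMat_mem hJ s⟩ : ↥(unitaryGroupOfForm (starRingEnd ℂ) J)))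
       one_mem' := ⟨0, Subtype.ext archPlaneLiftGL_rotMat_zero⟩
       mul_mem' := by
         rintro _ _ ⟨s, rfl⟩ ⟨t, rfl⟩
         exact ⟨s + t, Subtype.ext (archPlaneLiftGL_rotMat_add s t)⟩
       inv_mem' := by
         rintro _ ⟨s, rfl⟩
         exact ⟨-s, Subtype.ext (by rw [Subgroup.coe_inv]; exact archPlaneLiftGL_rotMat_neg s)⟩ }, rfl⟩
  have hKmem : ∀ s : AddCircle (2 * Real.pi),
      (⟨archPlaneLiftGL 1 (rotMat s) (det_rotMat s), archPlaneLiftGL_rotMat_mem hJ s⟩ : ↥(unitaryGroupOfForm (starRingEnd ℂ) J)) ∈ K₁ := fun s => by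
    rw [← SetLike.mem_coe, hK₁def]; exact ⟨s, rfl⟩
  have hKmem' : ∀ k ∈ K₁, ∃ s : AddCircle (2 * Real.pi),
      k = (⟨archPlaneLiftGL 1 (rotMat s) (det_rotMat s), archPlaneLiftGL_rotMat_mem hJ s⟩ : ↥(unitaryGroupOfForm (starRingEnd ℂ) J)) := fun k hk => by
    rw [← SetLike.mem_coe, hK₁def] at hk
    obtain ⟨s, hs⟩ := hk
    exact ⟨s, hs.symm⟩
  have hK₁ : IsCompact (K₁ : Set ↥(unitaryGroupOfForm (starRingEnd ℂ) J)) := by rw [hK₁def]; exact isCompact_range_rotLift hJ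
  have hKB : ∀ g : ↥(unitaryGroupOfForm (starRingEnd ℂ) J), ∃ k ∈ K₁, ∃ b ∈ borelU (starRingEnd ℂ) J, g = k * b := by
    intro g
    obtain ⟨s, b, hb, hg⟩ := exists_rotLift_mul_mem_borelU hJ g
    exact ⟨_, hKmem s, b, hb, hg⟩
  haveI : CompactSpace ↥K₁ := isCompact_iff_compactSpace.1 hK₁
  haveI : BorelSpace ↥K₁ := Subtype.borelSpace _
  obtain ⟨κ, hκ⟩ : ∃ κ : Measure ↥K₁, IsHaarMeasure κ := ⟨_, isHaarMeasure_map_rotLift hJ K₁ hKmem hKmem'⟩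
  haveI := hκ
  obtain ⟨μN, hμN⟩ : ∃ μN : Measure ↥(unipotentU (starRingEnd ℂ) J), IsHaarMeasure μN := ⟨Measure.haar, inferInstance⟩
  haveI := hμN
  obtain ⟨C', hC'0, hμC⟩ := exists_measure_quotient_torusU_complex_two_eq_smul_map hJ hK₁ hKB κ
    (Measure.haar : Measure ↥(torusU (starRingEnd ℂ) J)) μN μ₀' hμ0
  -- the split-frame Casimir and (B-r1): ONE `κ₀` for all test functions
  obtain ⟨κ₀, -, hBr1⟩ := exists_hasOneSidedJump_iteratedDeriv_allOrders_chart_of_eq_over L w hJ μ₀ κ μN hK₁ hKB _ (fun _ _ => rfl)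
  -- the two readers (centre `e^{i0} = 1`, i.e. (B-r1)'s tokens at `θ = 0`)
  obtain ⟨Φ₁, hΦ₁⟩ : ∃ Φ₁ : (Matrix (Fin 2) (Fin 2) ℂ → ℂ) → ℝ → ℂ, ∀ (F : Matrix (Fin 2) (Fin 2) ℂ → ℂ) (ψ : ℝ), Φ₁ F ψ = (2 * Real.sin ψ : ℂ) *
      ∫ h : ↥(unitaryGroupOfForm (starRingEnd ℂ) J), F (((h * (⟨(Matrix.GeneralLinearGroup.mkOfDetNeZero !![(1 : ℂ), 1; 1, -1] det_cayleyTwo_ne_zero) * circleDiagonal 2 ![Circle.exp 0 * Circle.exp ψ, Circle.exp 0 * Circle.exp (-ψ)] * ((Matrix.GeneralLinearGroup.mkOfDetNeZero !![(1 : ℂ), 1; 1, -1] det_cayleyTwo_ne_zero))⁻¹,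
            cayley_conj_circleDiagonal_mem_of_eq_over hJ _⟩ : ↥(unitaryGroupOfForm (starRingEnd ℂ) J)) * h⁻¹ : ↥(unitaryGroupOfForm (starRingEnd ℂ) J)) : GL (Fin 2) ℂ) : Matrix (Fin 2) (Fin 2) ℂ) ∂μ₀ := ⟨fun F ψ => _, fun _ _ => rfl⟩
  obtain ⟨Φ₂, hΦ₂⟩ : ∃ Φ₂ : (Matrix (Fin 2) (Fin 2) ℂ → ℂ) → ℝ → ℂ, ∀ (F : Matrix (Fin 2) (Fin 2) ℂ → ℂ) (x : ℝ), Φ₂ F x =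
      ∫ p : ↥K₁ × ↥(unipotentU (starRingEnd ℂ) J), F ((((((p.1 : ↥K₁) : ↥(unitaryGroupOfForm (starRingEnd ℂ) J)) * ((⟨hypBlockGL 0 0, hypBlockGL_mem_of_eq_over hJ 0 0⟩ : ↥(unitaryGroupOfForm (starRingEnd ℂ) J)) * (⟨hypBlockGL (x / 2) 0, hypBlockGL_mem_of_eq_over hJ (x / 2) 0⟩ : ↥(unitaryGroupOfForm (starRingEnd ℂ) J)) * ((p.2 : ↥(unipotentU (starRingEnd ℂ) J)) : ↥(unitaryGroupOfForm (starRingEnd ℂ) J)) * (⟨hypBlockGL (x / 2) 0, hypBlockGL_mem_of_eq_over hJ (x / 2) 0⟩ : ↥(unitaryGroupOfForm (starRingEnd ℂ) J))) * ((p.1 : ↥K₁) : ↥(unitaryGroupOfForm (starRingEnd ℂ) J))⁻¹ : ↥(unitaryGroupOfForm (starRingEnd ℂ) J))) : GL (Fin 2) ℂ) : Matrix (Fin 2) (Fin 2) ℂ) ∂(κ.prod μN) := ⟨fun F x => _, fun _ _ => rfl⟩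
  have hΦ₁' : ∀ (F : Matrix (Fin 2) (Fin 2) ℂ → ℂ) (ψ : ℝ), Φ₁ F ψ = (2 * Real.sin ψ) •
      ∫ h : ↥(unitaryGroupOfForm (starRingEnd ℂ) J), F (((h * (⟨(Matrix.GeneralLinearGroup.mkOfDetNeZero !![(1 : ℂ), 1; 1, -1] det_cayleyTwo_ne_zero) * circleDiagonal 2 ![Circle.exp 0 * Circle.exp ψ, Circle.exp 0 * Circle.exp (-ψ)] * ((Matrix.GeneralLinearGroup.mkOfDetNeZero !![(1 : ℂ), 1; 1, -1] det_cayleyTwo_ne_zero))⁻¹,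
            cayley_conj_circleDiagonal_mem_of_eq_over hJ _⟩ : ↥(unitaryGroupOfForm (starRingEnd ℂ) J)) * h⁻¹ : ↥(unitaryGroupOfForm (starRingEnd ℂ) J)) : GL (Fin 2) ℂ) : Matrix (Fin 2) (Fin 2) ℂ) ∂μ₀ := fun F ψ => by
    rw [hΦ₁, Complex.real_smul, Complex.ofReal_mul, Complex.ofReal_ofNat]
  -- the admissible families and the parameter derivative
  obtain ⟨Adm, hAdm⟩ : ∃ Adm : (({w : InfinitePlace L // IsComplex w} → Fin 3 → ℝ) → Matrix (Fin 2) (Fin 2) ℂ → ℂ) → Prop, ∀ g, Adm g ↔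
      (ContDiff ℝ ∞ (Function.uncurry g) ∧ ∃ C : Set (Matrix (Fin 2) (Fin 2) ℂ), IsCompact C ∧ ∀ (q : {w : InfinitePlace L // IsComplex w} → Fin 3 → ℝ) (X : Matrix (Fin 2) (Fin 2) ℂ), X ∉ C → g q X = 0) := ⟨_, fun _ => Iff.rfl⟩
  obtain ⟨D, hD⟩ : ∃ D : ({w : InfinitePlace L // IsComplex w} → Fin 3 → ℝ) → (({w : InfinitePlace L // IsComplex w} → Fin 3 → ℝ) → Matrix (Fin 2) (Fin 2) ℂ → ℂ) → (({w : InfinitePlace L // IsComplex w} → Fin 3 → ℝ) → Matrix (Fin 2) (Fin 2) ℂ → ℂ),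
      ∀ v g, D v g = fun q X => fderiv ℝ (fun q' => g q' X) q v := ⟨_, fun _ _ => rfl⟩
  have hcl : ∀ g, Adm g → ∀ v, Adm (D v g) := by
    intro g hg v
    obtain ⟨h1, C, hC, h0⟩ := (hAdm g).1 hg
    rw [hD]
    exact (hAdm _).2 ⟨contDiff_uncurry_fderiv_apply h1 v, C, hC, forall_fderiv_apply_eq_zero_of_support h0 v⟩
  -- (H1)(H2) for both readers
  have hT₁ : IsOpen {ψ : ℝ | Real.sin ψ ≠ 0} := isOpen_ne_fun Real.continuous_sin continuous_const
  have hrayT : ∀ᶠ t : ℝ in 𝓝[≠] 0, t ∈ {ψ : ℝ | Real.sin ψ ≠ 0} := by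
    have hI : Set.Ioo (-Real.pi) Real.pi ∈ 𝓝 (0 : ℝ) := Ioo_mem_nhds (neg_lt_zero.2 Real.pi_pos) Real.pi_pos
    filter_upwards [mem_nhdsWithin_of_mem_nhds hI, self_mem_nhdsWithin] with t ht ht0
    intro hsin
    exact ht0 ((Real.sin_eq_zero_iff_of_lt_of_lt ht.1 ht.2).1 hsin)
  -- the jump for EVERY admissible family, ONE `κ₀`
  have hjumpAll : ∀ (p : {w : InfinitePlace L // IsComplex w} → Fin 3 → ℝ) (g' : ({w : InfinitePlace L // IsComplex w} → Fin 3 → ℝ) → Matrix (Fin 2) (Fin 2) ℂ → ℂ), Adm g' → ∀ a : ℕ,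
      HasOneSidedJump (fun t : ℝ => iteratedDeriv a (Φ₁ (g' p)) t) ((κ₀ : ℂ) * I ^ a * iteratedDeriv a (Φ₂ (g' p)) 0) := by
    intro p g' hg' a
    obtain ⟨h1, C, hC, h0⟩ := (hAdm g').1 hg'
    have hs : ContDiff ℝ ∞ (g' p) := h1.comp (contDiff_const.prodMk contDiff_id)
    have hcs : HasCompactSupport (g' p) := HasCompactSupport.intro hC (fun X hX => h0 p X hX)
    exact hBr1 (g' p) hs hcs 0 Φ₁ hΦ₁ Φ₂ hΦ₂ a
  -- the constant
  refine ⟨I * (κ₀ : ℂ) / ((C' : ℝ) : ℂ), fun a' ha' p hp n m => ?_⟩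
  -- (B-desc-hyp): ONE `K`, ONE block family `f`, the smooth split token `G`
  obtain ⟨K, U, U'', f, G, hK, hU, hpU, hU'', hpU'', -, hf, ⟨C, hC, hfC⟩, htan, hcpt, -, hG, hGtoken, hEqOn, -⟩ :=
    exists_twoChart_descent_orbFamGExt_realWall L α ν' hα hreal hJ μ₀ μ₀' hlink hS' hw hwsp hp ha'
  -- the split token in `K × N` currency, through `x = 0`
  have hGΛ : ∀ (q : {w : InfinitePlace L // IsComplex w} → Fin 3 → ℝ) (x θ : ℝ), G (q, x, θ) = (C' : ℝ) • ∫ p : ↥K₁ × ↥(unipotentU (starRingEnd ℂ) J), f (q, ((((((p.1 : ↥K₁) : ↥(unitaryGroupOfForm (starRingEnd ℂ) J)) * ((⟨hypBlockGL 0 θ, hypBlockGL_mem_of_eq_over hJ 0 θ⟩ : ↥(unitaryGroupOfForm (starRingEnd ℂ) J)) * (⟨hypBlockGL (x / 2) 0, hypBlockGL_mem_of_eq_over hJ (x / 2) 0⟩ : ↥(unitaryGroupOfForm (starRingEnd ℂ) J)) * ((p.2 : ↥(unipotentU (starRingEnd ℂ) J)) : ↥(unitaryGroupOfForm (starRingEnd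 ℂ) J)) * (⟨hypBlockGL (x / 2) 0, hypBlockGL_mem_of_eq_over hJ (x / 2) 0⟩ : ↥(unitaryGroupOfForm (starRingEnd ℂ) J))) * ((p.1 : ↥K₁) : ↥(unitaryGroupOfForm (starRingEnd ℂ) J))⁻¹ : ↥(unitaryGroupOfForm (starRingEnd ℂ) J))) : GL (Fin 2) ℂ) : Matrix (Fin 2) (Fin 2) ℂ)) ∂(κ.prod μN) :=
    fun q x θ => eq_smul_integral_prod_of_splitToken hJ κ μN μ₀' hK₁ hμC f hf.continuous hC hfC G hG.continuous hGtoken q x θ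
  -- the centre-absorbed family
  have hcoord : ∀ (w' : {w : InfinitePlace L // IsComplex w}) (l : Fin 3), ContDiff ℝ ∞ fun q : {w : InfinitePlace L // IsComplex w} → Fin 3 → ℝ => q w' l := fun w' l => contDiff_apply_apply (𝕜 := ℝ) (E := ℝ) w' l
  have hzc : ContDiff ℝ ∞ fun q : {w : InfinitePlace L // IsComplex w} → Fin 3 → ℝ => ((Circle.exp ((q w 0 + q w 2) / 2) : Circle) : ℂ) :=
    contDiff_coe_circleExp_comp_of_contDiff (((hcoord w 0).add (hcoord w 2)).div_const 2)
  -- the cofactor carrier `Q` and the frozen cofactors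
  have hQ : IsOpen {q : {w : InfinitePlace L // IsComplex w} → Fin 3 → ℝ | ∀ w' ∈ S', w' ≠ w → q w' 0 ≠ 0} := isOpen_setOf_forall_mem_apply_ne_zero S' w
  have hpQ : p ∈ {q : {w : InfinitePlace L // IsComplex w} → Fin 3 → ℝ | ∀ w' ∈ S', w' ≠ w → q w' 0 ≠ 0} := fun w' hw' _ => hp.2.2.2 w' hw'
  -- the regular neighbourhoods
  obtain ⟨U₀, hU₀, hpU₀, -, hU₀1, hU₀2, hU₀3, hU₀4⟩ := exists_nhds_hcSemireg hw (show (0 : Fin 3) ≠ 2 by decide) hp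
  have hU₂ : IsOpen (U'' ∩ InRegG (slotSign L α) (insert w S')) := hU''.inter (isOpen_inRegG _ _)
  have hpU₂ : hcCayPt w 0 2 p ∈ U'' ∩ InRegG (slotSign L α) (insert w S') := ⟨hpU'', hcCayPt_mem_inRegG_insert (slotSign L α) hp⟩
  -- the atoms of ★ (B-trans): family, cofactors, Wick pair, the two genuine families
  obtain ⟨g, hgdef⟩ : ∃ g : ({w : InfinitePlace L // IsComplex w} → Fin 3 → ℝ) → Matrix (Fin 2) (Fin 2) ℂ → ℂ,
      g = fun (q : {w : InfinitePlace L // IsComplex w} → Fin 3 → ℝ) (X : Matrix (Fin 2) (Fin 2) ℂ) => f (q, ((Circle.exp ((q w 0 + q w 2) / 2) : Circle) : ℂ) • X) := ⟨_, rfl⟩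
  have hg : Adm g := by
    rw [hgdef]
    exact (hAdm _).2 ⟨contDiff_uncurry_centreAbsorb f hf _ hzc, exists_isCompact_forall_centreAbsorb_eq_zero f hC hfC (fun q => Circle.exp ((q w 0 + q w 2) / 2))⟩
  obtain ⟨Pf, hPf⟩ : ∃ Pf : ({w : InfinitePlace L // IsComplex w} → Fin 3 → ℝ) → ℂ, Pf = fun q : {w : InfinitePlace L // IsComplex w} → Fin 3 → ℝ => (∏ w' ∈ Finset.univ.erase w,
            ((if w' ∈ S' then (1 : ℂ) else (Circle.exp (q w' 0 - q w' 2) : ℂ)) *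
              (if w' ∈ S' then
                  ((|Real.exp (q w' 0) - Real.exp (-q w' 0)| *
                    ‖cexp (q w' 0 + q w' 2 * I) - cexp (q w' 1 * I)‖ * ‖cexp (-q w' 0 + q w' 2 * I) - cexp (q w' 1 * I)‖ : ℝ) : ℂ)
                else (1 - (Circle.exp (q w' 1 - q w' 0) : ℂ)) * (1 - (Circle.exp (q w' 2 - q w' 0) : ℂ)) * (1 - (Circle.exp (q w' 2 - q w' 1) : ℂ))))) := ⟨_, rfl⟩
  obtain ⟨Ef, hEf⟩ : ∃ Ef : ({w : InfinitePlace L // IsComplex w} → Fin 3 → ℝ) → ℂ, Ef = fun q : {w : InfinitePlace L // IsComplex w} → Fin 3 → ℝ =>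
      (((2 * Real.cos (q w 0 - q w 1) - 2 * Real.cos 0 : ℝ)) : ℂ) * (∏ w' ∈ Finset.univ.erase w,
            ((if w' ∈ S' then (1 : ℂ) else (Circle.exp (q w' 0 - q w' 2) : ℂ)) *
              (if w' ∈ S' then
                  ((|Real.exp (q w' 0) - Real.exp (-q w' 0)| *
                    ‖cexp (q w' 0 + q w' 2 * I) - cexp (q w' 1 * I)‖ * ‖cexp (-q w' 0 + q w' 2 * I) - cexp (q w' 1 * I)‖ : ℝ) : ℂ)
                else (1 - (Circle.exp (q w' 1 - q w' 0) : ℂ)) * (1 - (Circle.exp (q w' 2 - q w' 0) : ℂ)) * (1 - (Circle.exp (q w' 2 - q w' 1) : ℂ))))) := ⟨_, rfl⟩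
  have hPfs : ContDiffOn ℝ ∞ Pf {q : {w : InfinitePlace L // IsComplex w} → Fin 3 → ℝ | ∀ w' ∈ S', w' ≠ w → q w' 0 ≠ 0} := by rw [hPf]; exact contDiffOn_frozenProd S' w
  have hEfs : ContDiffOn ℝ ∞ Ef {q : {w : InfinitePlace L // IsComplex w} → Fin 3 → ℝ | ∀ w' ∈ S', w' ≠ w → q w' 0 ≠ 0} := by rw [hEf]; exact contDiffOn_twoCosSub_mul_frozenProd S' w 0
  obtain ⟨ce, hce⟩ : ∃ ce : ℝ → ℂ, ce = fun t : ℝ => (((2 * Real.cos t - 2 * Real.cos 0 : ℝ)) : ℂ) := ⟨_, rfl⟩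
  obtain ⟨ch, hch⟩ : ∃ ch : ℝ → ℂ, ch = fun x : ℝ => (((2 * Real.cosh x - 2 * Real.cos 0 : ℝ)) : ℂ) := ⟨_, rfl⟩
  have hces : ContDiff ℝ ∞ ce := by rw [hce]; exact contDiff_ofReal_two_cos_sub 0
  have hchs : ContDiff ℝ ∞ ch := by rw [hch]; exact contDiff_ofReal_two_cosh_sub 0
  have hwick : ∀ a : ℕ, iteratedDeriv a ce 0 = I ^ a * iteratedDeriv a ch 0 := by
    intro a; rw [hce, hch]; exact iteratedDeriv_ofReal_two_cos_sub_zero_eq_I_pow_mul 0 a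
  obtain ⟨F₁, hF₁⟩ : ∃ F₁ : ({w : InfinitePlace L // IsComplex w} → Fin 3 → ℝ) → ℂ, F₁ = fun c => archERhoG S' c * orbFamGExt L α ν' a' S' c := ⟨_, rfl⟩
  obtain ⟨F₂, hF₂⟩ : ∃ F₂ : ({w : InfinitePlace L // IsComplex w} → Fin 3 → ℝ) → ℂ, F₂ = fun c => archERhoG (insert w S') c * orbFamGExt L α ν' a' (insert w S') c := ⟨_, rfl⟩
  -- (H1)(H2) for both readers
  have h11 : ∀ g', Adm g' → ContDiffOn ℝ ∞ (fun z : ({w : InfinitePlace L // IsComplex w} → Fin 3 → ℝ) × ℝ => Φ₁ (g' z.1) z.2)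
      ({q : {w : InfinitePlace L // IsComplex w} → Fin 3 → ℝ | ∀ w' ∈ S', w' ≠ w → q w' 0 ≠ 0} ×ˢ {ψ : ℝ | Real.sin ψ ≠ 0}) := by
    intro g' hg'
    obtain ⟨h1, h2⟩ := (hAdm g').1 hg'
    exact (contDiffOn_cayley_orbitalIntegral_param hJ μ₀ (Circle.exp 0) Φ₁ hΦ₁' g' h1 h2).mono (Set.prod_mono (Set.subset_univ _) le_rfl)
  have h21 : ∀ g', Adm g' → ∀ (v : {w : InfinitePlace L // IsComplex w} → Fin 3 → ℝ) (z : ({w : InfinitePlace L // IsComplex w} → Fin 3 → ℝ) × ℝ),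
      z ∈ {q : {w : InfinitePlace L // IsComplex w} → Fin 3 → ℝ | ∀ w' ∈ S', w' ≠ w → q w' 0 ≠ 0} ×ˢ {ψ : ℝ | Real.sin ψ ≠ 0} →
        fderiv ℝ (fun z : ({w : InfinitePlace L // IsComplex w} → Fin 3 → ℝ) × ℝ => Φ₁ (g' z.1) z.2) z (v, 0) = Φ₁ (D v g' z.1) z.2 := by
    intro g' hg' v z hz
    obtain ⟨h1, h2⟩ := (hAdm g').1 hg'
    rw [hD]
    exact fderiv_cayley_orbitalIntegral_param_prod_apply hJ μ₀ (Circle.exp 0) Φ₁ hΦ₁' g' h1 h2 v hz.2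
  have h12 : ∀ g', Adm g' → ContDiffOn ℝ ∞ (fun z : ({w : InfinitePlace L // IsComplex w} → Fin 3 → ℝ) × ℝ => Φ₂ (g' z.1) z.2)
      ({q : {w : InfinitePlace L // IsComplex w} → Fin 3 → ℝ | ∀ w' ∈ S', w' ≠ w → q w' 0 ≠ 0} ×ˢ (univ : Set ℝ)) := by
    intro g' hg'
    obtain ⟨h1, h2⟩ := (hAdm g').1 hg'
    exact (contDiff_splitIntegral_param hJ κ μN hK₁ 0 Φ₂ hΦ₂ g' h1 h2).contDiffOn
  have h22 : ∀ g', Adm g' → ∀ (v : {w : InfinitePlace L // IsComplex w} → Fin 3 → ℝ) (z : ({w : InfinitePlace L // IsComplex w} → Fin 3 → ℝ) × ℝ),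
      z ∈ {q : {w : InfinitePlace L // IsComplex w} → Fin 3 → ℝ | ∀ w' ∈ S', w' ≠ w → q w' 0 ≠ 0} ×ˢ (univ : Set ℝ) →
        fderiv ℝ (fun z : ({w : InfinitePlace L // IsComplex w} → Fin 3 → ℝ) × ℝ => Φ₂ (g' z.1) z.2) z (v, 0) = Φ₂ (D v g' z.1) z.2 := by
    intro g' hg' v z _
    obtain ⟨h1, h2⟩ := (hAdm g').1 hg'
    rw [hD]
    exact fderiv_splitIntegral_param_prod_apply hJ κ μN hK₁ 0 Φ₂ hΦ₂ g' h1 h2 v z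
  -- the two dresses (PART 1)
  have hdesc₁ : ∀ c ∈ U ∩ U₀, ((c w 0 - c w 2) / 2) ∈ {ψ : ℝ | Real.sin ψ ≠ 0} →
      F₁ c = (K * I) * (ce ((c w 0 - c w 2) / 2) * Pf (c - ((c w 0 - c w 2) / 2) • hcNrm w 0 2) - Ef (c - ((c w 0 - c w 2) / 2) • hcNrm w 0 2)) * Φ₁ (g (c - ((c w 0 - c w 2) / 2) • hcNrm w 0 2)) ((c w 0 - c w 2) / 2) := by
    intro c hc hνT
    have hne : c w 0 ≠ c w 2 := by
      intro h
      apply hνT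
      show Real.sin ((c w 0 - c w 2) / 2) = 0
      rw [h, sub_self, zero_div, Real.sin_zero]
    have hcreg : c ∈ RegG S' := mem_regG_of_offWall (show (0 : Fin 3) ≠ 2 by decide) (hU₀1 c hc.2) (hU₀2 c hc.2) (hU₀3 c hc.2) (hU₀4 c hc.2) hne
    rw [hF₁, hce, hPf, hEf, hΦ₁, hgdef]
    exact archERhoG_mul_orbFamGExt_eq_compactReader L α ν' a' hJ μ₀ hS' hw htan hcpt 0 hc.1 hcreg
  have hdesc₂ : ∀ c ∈ U'' ∩ InRegG (slotSign L α) (insert w S'),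
      F₂ c = (K * ((C' : ℝ) : ℂ)) * (ch (c w 0) * Pf (Function.update c w (fun s => if s = hcThird 0 2 then c w 1 else c w 2)) - Ef (Function.update c w (fun s => if s = hcThird 0 2 then c w 1 else c w 2))) * Φ₂ (g (Function.update c w (fun s => if s = hcThird 0 2 then c w 1 else c w 2))) (c w 0) := by
    intro c hc
    rw [hF₂, hch, hPf, hEf, hΦ₂, hgdef]
    exact archERhoG_mul_orbFamGExt_eq_splitReader L α ν' a' hJ κ μN S' w htan hGΛ 0 (hEqOn hc)
  have hK₂ : K * ((C' : ℝ) : ℂ) ≠ 0 := mul_ne_zero hK (by exact_mod_cast (NNReal.coe_ne_zero.2 hC'0))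
  -- ★ (B-trans)
  have key := hasOneSidedJump_iteratedFDeriv_adaptedWord_of_twoChart w (show (0 : Fin 3) ≠ 2 by decide) Φ₁ Φ₂ hT₁ hrayT Adm D hcl hQ
    h11 h21 h12 h22 g hg Pf Ef hPfs hEfs ce ch hces hchs hwick (K * I) (K * ((C' : ℝ) : ℂ)) (κ₀ : ℂ) hK₂ hp.1 hpQ F₁ F₂
    (hU.inter hU₀) ⟨hpU, hpU₀⟩ hU₂ hpU₂ hdesc₁ hdesc₂ (hjumpAll p) n m
  have hconst : K * I / (K * ((C' : ℝ) : ℂ)) * (κ₀ : ℂ) = I * (κ₀ : ℂ) / ((C' : ℝ) : ℂ) := by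
    rw [mul_div_mul_left _ _ hK]; ring
  rw [hconst, hF₁, hF₂] at key
  simp only [hcTwistedDeriv]
  exact key

end Main

end Literature.NumberTheory.Rogawski1990

end
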